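import Literature.AlgebraicGeometry.Motives.HodgeLieWeightOneRankFourSplitting
import Literature.AlgebraicGeometry.Motives.HodgeThetaSubalgebraReductive
import HarnessLib

/-!
# Weight-one Hodge structures whose Hodge Lie algebra has a three-dimensional derived algebra and ARBITRARY centre.
# A: the centre commutes with `𝔥_ℂ`, brackets lie in `𝔡_ℂ`, and `𝔡_ℂ = ℂE ⊕ ℂF ⊕ ℂ[E, F]` when `dim_ℚ 𝔡 = 3`

Family `hodge`, layer `Literature/AlgebraicGeometry/Motives`; THEOREMS ONLY (no definition, no named fact; D-0026).
First abstract file of the lane MT-RANK-SIX-ISOGENY of the cell `pub-hodgecm2` (COR-CM), seat `b27`: the generalisation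
of the lane MT-RANK-FIVE (`Motives/HodgeLieWeightOneRankFour{Blocks,Basis,Center,Splitting,Cube,Corner,Range}`, where
`dim_ℚ 𝔥 = 4`, i.e. the centre `𝔷` is a line `ℚφ`) to a centre of any dimension.

SETTING.  `H` a polarizable `ℚ`-Hodge structure of weight `1` on a finite-dimensional `V` with polarization `ψ`, `e` a
graded basis with degrees in `{0,1}`, `P = gradingEnd e deg` the projector onto `V^{1,0}`, `𝔥 = Lie Hg(H)`,
`𝔥_ℂ = H.hodgeLieC`, `X ∈ 𝔥 ∖ End_Hdg(V)` rational, `E = P X_ℂ (1 − P)`, `F = (1 − P) X_ℂ P`;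
`𝔷 = 𝔥 ∩ End_Hdg(V)` the CENTRE of `𝔥` and `𝔡 = span_ℚ {[X₁, X₂] | Xᵢ ∈ 𝔥}` its DERIVED ALGEBRA
(`Motives/HodgeThetaSubalgebraReductive`: `𝔥 = 𝔷 ⊕ 𝔡`); HYPOTHESIS `dim_ℚ 𝔡 = 3` (for `H¹` of a complex abelian variety
NOT of CM type this holds exactly when `dim MT(H¹) ≤ 6`, `Summits/HodgeConjecture/CorCM/MumfordTateRankSix`).

* §0 `spanC_sup`, `commute_of_mem_spanC_center`, `bracket_mem_spanC_derived` — bookkeeping: `(𝔞 ⊔ 𝔟)_ℂ = 𝔞_ℂ ⊔ 𝔟_ℂ`;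
  the elements of `𝔷_ℂ` commute with `P` and with `𝔥_ℂ`; brackets of elements of `𝔥_ℂ` lie in `𝔡_ℂ`; hence
  `E, F ∈ 𝔡_ℂ` (`projE_mem_spanC_derived`: `2E = [P, X_ℂ] + [P, [P, X_ℂ]]`).
* §1 `exists_coeffs_of_mem_spanC_derived` — **`𝔡_ℂ = ℂE ⊕ ℂF ⊕ ℂ[E, F]`** (three independent elements of the
  three-dimensional `𝔡_ℂ`).
* The sequel `Motives/HodgeLieWeightOneSl2CenterCommutator` derives `[E, F] = α(2P − 1) + ζ₀` (`α ≠ 0`, `ζ₀ ∈ 𝔷_ℂ`),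
  `𝔥_ℂ = ℂ(2P−1) ⊕ ℂE ⊕ ℂF ⊕ 𝔷_ℂ` and `ζ₀ E = ζ₀ F = 0`.

Classically (Moonen–Zarhin 1999 §2, Deligne LNM 900 I §3): `Hg⁰ = SL₂ · Z` with `Z` a torus of Hodge endomorphisms;
the sequels `Motives/HodgeLieWeightOneSl2CenterCommutator`, `…Splitting` prove that `Z` acts trivially where `SL₂`
acts non-trivially and split `V` accordingly.

## References

* [MoonenZarhin1999LowDim] B. Moonen, Yu. Zarhin, *Hodge classes on abelian varieties of low dimension*, Math. Ann. 315
  (1999), §2 (Hodge group, reductivity, `End⁰(X) = End_{Hg} H¹`).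
* [Deligne1982HodgeCycles] P. Deligne, *Hodge cycles on abelian varieties*, LNM 900 (1982), I §3 (3.1–3.6).
* [FultonHarris1991] W. Fulton, J. Harris, *Representation Theory*, GTM 129 (1991), Lecture 11 (§11.1), §9.3.
-/

noncomputable section

open scoped TensorProduct

namespace Literature.AlgebraicGeometry.Motives

universe u

namespace HodgeStructure

open ProjectorBlocks Literature.RepresentationTheory.GeneralLinear

variable {V : Type u} [AddCommGroup V] [Module ℚ V] [Module.Finite ℚ V] [HodgeTensorFacts.{u, u}] {n : ℤ}
  {S : Type u} [Fintype S] [DecidableEq S] {deg : S → ℤ}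

/-! ## §0 Bookkeeping: complex spans of sums, the centre commutes, brackets lie in the derived algebra -/

omit [Module.Finite ℚ V] [HodgeTensorFacts.{u, u}] in
/-- `(𝔞 ⊔ 𝔟)_ℂ = 𝔞_ℂ ⊔ 𝔟_ℂ` for rational subspaces of `End_ℚ V`. [cite: Deligne1982HodgeCycles, I §3 (proof of Prop. 3.4)] -/
theorem spanC_sup (𝔞 𝔟 : Submodule ℚ (Module.End ℚ V)) : spanC (𝔞 ⊔ 𝔟) = spanC 𝔞 ⊔ spanC 𝔟 := by
  apply le_antisymm
  · unfold spanC
    rw [Submodule.span_le]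
    rintro _ ⟨Z, hZ, rfl⟩
    obtain ⟨a, ha, b, hb, rfl⟩ := Submodule.mem_sup.1 hZ
    change (a + b).baseChange ℂ ∈ _
    rw [LinearMap.baseChange_add]
    exact Submodule.add_mem_sup (baseChange_mem_spanC ha) (baseChange_mem_spanC hb)
  · unfold spanC
    exact sup_le (Submodule.span_mono (Set.image_mono fun Z hZ => Submodule.mem_sup_left hZ))
      (Submodule.span_mono (Set.image_mono fun Z hZ => Submodule.mem_sup_right hZ))

/-- **The elements of `𝔷_ℂ` (`𝔷 = 𝔥 ∩ End_Hdg(V)`) commute with every element of `𝔥_ℂ`** (`𝔥` commutes with the Hodge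
endomorphisms, `commute_baseChange_of_mem_hodgeLieC`). [cite: MoonenZarhin1999LowDim, §2] -/
theorem commute_of_mem_spanC_center (H : HodgeStructure V n) {ζ : Module.End ℂ (ℂ ⊗[ℚ] V)}
    (hζ : ζ ∈ spanC (H.hodgeLie ⊓ Subalgebra.toSubmodule H.endAlg)) {W : Module.End ℂ (ℂ ⊗[ℚ] V)}
    (hW : W ∈ H.hodgeLieC) : ζ * W = W * ζ := by
  unfold spanC at hζ
  induction hζ using Submodule.span_induction with
  | mem Z hZ =>
    obtain ⟨Z₀, hZ₀, rfl⟩ := hZ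
    have hZ₀A : Z₀ ∈ H.endAlg := (Submodule.mem_inf.1 hZ₀).2
    exact (commute_baseChange_of_mem_hodgeLieC H hW ⟨Z₀, hZ₀A⟩).symm
  | zero => rw [zero_mul, mul_zero]
  | add x y _ _ hx hy => rw [add_mul, mul_add, hx, hy]
  | smul c x _ hx => rw [smul_mul_assoc, mul_smul_comm, hx]

/-- The elements of `𝔷_ℂ` commute with the grading projector `P` (they commute with `2P − 1 ∈ 𝔥_ℂ`).
[cite: Deligne1982HodgeCycles, I §3 (3.1–3.4)] -/
theorem commute_gradingEnd_of_mem_spanC_center (H : HodgeStructure V n) (hn : n = 1)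
    (e : Module.Basis S ℂ (ℂ ⊗[ℚ] V)) (hF : ∀ a, H.F a = Submodule.span ℂ (e '' {σ | a ≤ deg σ}))
    (hFc : ∀ a, complexConj (H.F a) = Submodule.span ℂ (e '' {σ | deg σ ≤ n - a}))
    {ζ : Module.End ℂ (ℂ ⊗[ℚ] V)} (hζ : ζ ∈ spanC (H.hodgeLie ⊓ Subalgebra.toSubmodule H.endAlg)) :
    ζ * gradingEnd e deg = gradingEnd e deg * ζ := by
  subst hn
  have hΘ' : (2 : ℂ) • gradingEnd e deg - 1 ∈ H.hodgeLieC := by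
    simpa only [Int.cast_one, one_smul] using two_smul_gradingEnd_sub_mem_hodgeLieC H e hF hFc
  have h := commute_of_mem_spanC_center H hζ hΘ'
  rw [mul_sub ζ _ 1, sub_mul _ 1 ζ, mul_one, one_mul, mul_smul_comm, smul_mul_assoc, sub_left_inj] at h
  exact smul_right_injective _ (two_ne_zero' ℂ) h

/-- **Brackets of elements of `𝔥_ℂ` lie in `𝔡_ℂ`**, the complex span of the rational derived algebra
`𝔡 = span_ℚ {[X₁, X₂] | Xᵢ ∈ 𝔥}` (bilinearity: `commutator_mem_span_brackets`). [cite: FultonHarris1991, §9.3] -/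
theorem bracket_mem_spanC_derived (H : HodgeStructure V n) {W W' : Module.End ℂ (ℂ ⊗[ℚ] V)}
    (hW : W ∈ H.hodgeLieC) (hW' : W' ∈ H.hodgeLieC) :
    W * W' - W' * W ∈
      spanC (Submodule.span ℚ {B | ∃ X ∈ H.hodgeLie, ∃ Y ∈ H.hodgeLie, X * Y - Y * X = B}) := by
  have h := commutator_mem_span_brackets H hW hW'
  refine Submodule.span_le.2 ?_ h
  rintro _ ⟨⟨X₁, X₂⟩, ⟨hX₁, hX₂⟩, rfl⟩
  have hb : X₁ * X₂ - X₂ * X₁ ∈ Submodule.span ℚ {B | ∃ X ∈ H.hodgeLie, ∃ Y ∈ H.hodgeLie, X * Y - Y * X = B} :=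
    Submodule.subset_span ⟨X₁, hX₁, X₂, hX₂, rfl⟩
  have h' := baseChange_mem_spanC hb
  rw [LinearMap.baseChange_sub, LinearMap.baseChange_mul, LinearMap.baseChange_mul] at h'
  exact h'

/-- `𝔡_ℂ ⊆ 𝔥_ℂ` (`𝔡 ⊆ 𝔥` since `𝔥` is a Lie algebra). [cite: FultonHarris1991, §9.3] -/
theorem spanC_derived_le_hodgeLieC (H : HodgeStructure V n) :
    spanC (Submodule.span ℚ {B | ∃ X ∈ H.hodgeLie, ∃ Y ∈ H.hodgeLie, X * Y - Y * X = B}) ≤ H.hodgeLieC := by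
  rw [hodgeLieC_eq_spanC]
  unfold spanC
  apply Submodule.span_mono
  apply Set.image_mono
  intro B hB
  refine (Submodule.span_le.2 ?_) hB
  rintro _ ⟨X, hX, Y, hY, rfl⟩
  exact H.commutator_mem_hodgeLie hX hY

/-- **`E = P X_ℂ (1−P)` and `F = (1−P) X_ℂ P` lie in `𝔡_ℂ`** for `X ∈ 𝔥` (weight `1`, degrees in `{0,1}`):
`2E = [P, X_ℂ] + [P, [P, X_ℂ]]`, `2F = [P, [P, X_ℂ]] − [P, X_ℂ]`, and `[P, ·] = ½ [2P − 1, ·]` maps `𝔥_ℂ` into `𝔡_ℂ`.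
[cite: Deligne1982HodgeCycles, I §3 (proof of Prop. 3.4)] [cite: FultonHarris1991, Lecture 11 (§11.1)] -/
theorem projE_mem_spanC_derived (H : HodgeStructure V n) (hn : n = 1) (e : Module.Basis S ℂ (ℂ ⊗[ℚ] V))
    (hF : ∀ a, H.F a = Submodule.span ℂ (e '' {σ | a ≤ deg σ}))
    (hFc : ∀ a, complexConj (H.F a) = Submodule.span ℂ (e '' {σ | deg σ ≤ n - a}))
    (hdeg : ∀ σ, deg σ = 0 ∨ deg σ = 1) {X : Module.End ℚ V} (hX : X ∈ H.hodgeLie) :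
    gradingEnd e deg * X.baseChange ℂ * (1 - gradingEnd e deg) ∈
        spanC (Submodule.span ℚ {B | ∃ X ∈ H.hodgeLie, ∃ Y ∈ H.hodgeLie, X * Y - Y * X = B}) ∧
      (1 - gradingEnd e deg) * X.baseChange ℂ * gradingEnd e deg ∈
        spanC (Submodule.span ℚ {B | ∃ X ∈ H.hodgeLie, ∃ Y ∈ H.hodgeLie, X * Y - Y * X = B}) := by
  subst hn
  set 𝔡C := spanC (Submodule.span ℚ {B | ∃ X ∈ H.hodgeLie, ∃ Y ∈ H.hodgeLie, X * Y - Y * X = B}) with h𝔡C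
  set P := gradingEnd e deg with hP
  set Y := X.baseChange ℂ with hY
  set E := P * Y * (1 - P) with hEdef
  set F := (1 - P) * Y * P with hFdef
  have hPP : P * P = P := gradingEnd_mul_gradingEnd_of_deg e hdeg
  have hPE : P * E = E := by rw [hEdef, ← mul_assoc, ← mul_assoc, hPP]
  have hEP : E * P = 0 := by rw [hEdef, mul_assoc (P * Y) (1 - P) P, sub_mul, one_mul, hPP, sub_self, mul_zero]
  have hPF : P * F = 0 := by
    rw [hFdef, mul_assoc (1 - P) Y P, ← mul_assoc P (1 - P) (Y * P), mul_sub, mul_one, hPP, sub_self, zero_mul]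
  have hFP : F * P = F := by rw [hFdef, mul_assoc ((1 - P) * Y) P P, hPP]
  have hΘ' : (2 : ℂ) • P - 1 ∈ H.hodgeLieC := by
    simpa only [Int.cast_one, one_smul] using two_smul_gradingEnd_sub_mem_hodgeLieC H e hF hFc
  have hYM : Y ∈ H.hodgeLieC := H.baseChange_mem_hodgeLieC hX
  -- `[P, Y] = E − F`, `[P, E − F] = E + F`
  have hPY : P * Y - Y * P = E - F := by
    rw [hEdef, hFdef, mul_sub (P * Y) 1 P, mul_one, mul_assoc (1 - P) Y P, sub_mul 1 P (Y * P), one_mul,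
      ← mul_assoc P Y P]
    abel
  have hPEF : P * (E - F) - (E - F) * P = E + F := by
    rw [mul_sub, sub_mul, hPE, hPF, hEP, hFP, sub_zero, zero_sub, sub_neg_eq_add]
  -- `[P, W] ∈ 𝔡_ℂ` for `W ∈ 𝔥_ℂ`
  have hbr : ∀ W ∈ H.hodgeLieC, P * W - W * P ∈ 𝔡C := by
    intro W hW
    have h := bracket_mem_spanC_derived H hΘ' hW
    have h2 : ((2 : ℂ) • P - 1) * W - W * ((2 : ℂ) • P - 1) = (2 : ℂ) • (P * W - W * P) := by
      rw [sub_mul, mul_sub, smul_mul_assoc, mul_smul_comm, one_mul, mul_one, smul_sub]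
      abel
    rw [h2] at h
    have h' := 𝔡C.smul_mem (2 : ℂ)⁻¹ h
    rwa [smul_smul, inv_mul_cancel₀ (two_ne_zero' ℂ), one_smul] at h'
  have h1 : E - F ∈ 𝔡C := by rw [← hPY]; exact hbr Y hYM
  have hEFM : E - F ∈ H.hodgeLieC := by
    rw [← hPY]
    exact commutator_gradingEnd_mem_hodgeLieC H e hF hFc hYM
  have h2 : E + F ∈ 𝔡C := by rw [← hPEF]; exact hbr _ hEFM
  have hE2 : E = (2 : ℂ)⁻¹ • ((E - F) + (E + F)) := by
    rw [sub_add_add_cancel, ← two_smul ℂ E, smul_smul, inv_mul_cancel₀ (two_ne_zero' ℂ), one_smul]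
  have hF2 : F = (2 : ℂ)⁻¹ • ((E + F) - (E - F)) := by
    rw [add_sub_sub_cancel, ← two_smul ℂ F, smul_smul, inv_mul_cancel₀ (two_ne_zero' ℂ), one_smul]
  constructor
  · rw [hE2]; exact 𝔡C.smul_mem _ (𝔡C.add_mem h1 h2)
  · rw [hF2]; exact 𝔡C.smul_mem _ (𝔡C.sub_mem h2 h1)

/-! ## §1 `𝔡_ℂ = ℂE ⊕ ℂF ⊕ ℂ[E, F]` when `dim_ℚ 𝔡 = 3` -/

/-- **`𝔡_ℂ = ℂE ⊕ ℂF ⊕ ℂ[E, F]`.**  If the rational derived algebra `𝔡 = span_ℚ {[X₁, X₂] | Xᵢ ∈ 𝔥}` has dimension `3`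
(weight `1`, degrees in `{0,1}`, `X ∈ 𝔥 ∖ End_Hdg(V)`, `ψ` a polarization), every element of `𝔡_ℂ` is
`c₀ E + c₁ F + c₂ [E, F]`: the three lie in `𝔡_ℂ` (`projE_mem_spanC_derived`, `bracket_mem_spanC_derived`), are linearly
independent (the `(+)`-block of a relation is `c₀ E`, its `(−)`-block `c₁ F`, and `E, F, [E,F] ≠ 0` by
`projE_ne_zero_of_not_mem_endAlg`, `commutator_projE_projF_ne_zero`), and `dim_ℂ 𝔡_ℂ = dim_ℚ 𝔡 = 3`.
[cite: FultonHarris1991, Lecture 11 (§11.1)] [cite: MoonenZarhin1999LowDim, §2] -/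
theorem exists_coeffs_of_mem_spanC_derived (H : HodgeStructure V n) (ψ : H.Polarization) (hn : n = 1)
    (e : Module.Basis S ℂ (ℂ ⊗[ℚ] V)) (hF : ∀ a, H.F a = Submodule.span ℂ (e '' {σ | a ≤ deg σ}))
    (hFc : ∀ a, complexConj (H.F a) = Submodule.span ℂ (e '' {σ | deg σ ≤ n - a}))
    (hdeg : ∀ σ, deg σ = 0 ∨ deg σ = 1) {X : Module.End ℚ V} (hX : X ∈ H.hodgeLie) (hXE : X ∉ H.endAlg)
    (h3 : Module.finrank ℚ ↥(Submodule.span ℚ {B | ∃ X ∈ H.hodgeLie, ∃ Y ∈ H.hodgeLie, X * Y - Y * X = B}) = 3)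
    {D : Module.End ℂ (ℂ ⊗[ℚ] V)}
    (hD : D ∈ spanC (Submodule.span ℚ {B | ∃ X ∈ H.hodgeLie, ∃ Y ∈ H.hodgeLie, X * Y - Y * X = B})) :
    ∃ c : Fin 3 → ℂ, D = c 0 • (gradingEnd e deg * X.baseChange ℂ * (1 - gradingEnd e deg)) +
      c 1 • ((1 - gradingEnd e deg) * X.baseChange ℂ * gradingEnd e deg) +
      c 2 • ((gradingEnd e deg * X.baseChange ℂ * (1 - gradingEnd e deg)) *
          ((1 - gradingEnd e deg) * X.baseChange ℂ * gradingEnd e deg) -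
        ((1 - gradingEnd e deg) * X.baseChange ℂ * gradingEnd e deg) *
          (gradingEnd e deg * X.baseChange ℂ * (1 - gradingEnd e deg))) := by
  classical
  subst hn
  set 𝔡 := Submodule.span ℚ {B | ∃ X ∈ H.hodgeLie, ∃ Y ∈ H.hodgeLie, X * Y - Y * X = B} with h𝔡
  have hcomm0 := commutator_projE_projF_ne_zero H ψ rfl e hF hFc hdeg hX hXE
  obtain ⟨hE0, hF0⟩ := projE_ne_zero_of_not_mem_endAlg H rfl e hF hFc hdeg hXE
  obtain ⟨hEd, hFd⟩ := projE_mem_spanC_derived H rfl e hF hFc hdeg hX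
  set P := gradingEnd e deg with hP
  set Y := X.baseChange ℂ with hY
  set E := P * Y * (1 - P) with hEdef
  set F := (1 - P) * Y * P with hFdef
  have hPP : P * P = P := gradingEnd_mul_gradingEnd_of_deg e hdeg
  have hPE : P * E = E := by rw [hEdef, ← mul_assoc, ← mul_assoc, hPP]
  have hEP : E * P = 0 := by rw [hEdef, mul_assoc (P * Y) (1 - P) P, sub_mul, one_mul, hPP, sub_self, mul_zero]
  have hPF : P * F = 0 := by
    rw [hFdef, mul_assoc (1 - P) Y P, ← mul_assoc P (1 - P) (Y * P), mul_sub, mul_one, hPP, sub_self, zero_mul]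
  have hFP : F * P = F := by rw [hFdef, mul_assoc ((1 - P) * Y) P P, hPP]
  have hEQ : E * (1 - P) = E := by rw [mul_sub, mul_one, hEP, sub_zero]
  have hQF : (1 - P) * F = F := by rw [sub_mul, one_mul, hPF, sub_zero]
  have hYM : Y ∈ H.hodgeLieC := H.baseChange_mem_hodgeLieC hX
  obtain ⟨hEM, hFM⟩ := projE_mem_hodgeLieC H e hF hFc hdeg hYM
  rw [← hP, ← hEdef] at hEM
  rw [← hP, ← hFdef] at hFM
  have hBd : E * F - F * E ∈ spanC 𝔡 := bracket_mem_spanC_derived H hEM hFM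
  -- `[E, F]` commutes with `P`
  have hPB : P * (E * F - F * E) = E * F := by
    rw [mul_sub, ← mul_assoc P E F, ← mul_assoc P F E, hPE, hPF, zero_mul, sub_zero]
  have hBP : (E * F - F * E) * P = E * F := by
    rw [sub_mul, mul_assoc E F P, mul_assoc F E P, hFP, hEP, mul_zero, sub_zero]
  let v : Fin 3 → Module.End ℂ (ℂ ⊗[ℚ] V) := ![E, F, E * F - F * E]
  have hv : ∀ i, v i ∈ spanC 𝔡 := by
    intro i
    fin_cases i
    · exact hEd
    · exact hFd
    · exact hBd
  have hli : LinearIndependent ℂ v := by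
    rw [Fintype.linearIndependent_iff]
    intro g hg
    have hg' : g 0 • E + g 1 • F + g 2 • (E * F - F * E) = 0 := by
      simpa [Fin.sum_univ_three, v] using hg
    have hg0 : g 0 = 0 := by
      have h : P * (g 0 • E + g 1 • F + g 2 • (E * F - F * E)) * (1 - P) = P * 0 * (1 - P) :=
        congrArg (fun T : Module.End ℂ (ℂ ⊗[ℚ] V) => P * T * (1 - P)) hg'
      rw [mul_add, mul_add, add_mul, add_mul, mul_smul_comm, mul_smul_comm, mul_smul_comm, smul_mul_assoc,
        smul_mul_assoc, smul_mul_assoc, hPE, hEQ, hPF, zero_mul, smul_zero, add_zero, hPB, mul_assoc E F (1 - P),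
        mul_sub F 1 P, mul_one, hFP, sub_self, mul_zero, smul_zero, add_zero, mul_zero, zero_mul] at h
      exact (smul_eq_zero.1 h).resolve_right hE0
    rw [hg0, zero_smul, zero_add] at hg'
    have hg1 : g 1 = 0 := by
      have h : (1 - P) * (g 1 • F + g 2 • (E * F - F * E)) * P = (1 - P) * 0 * P :=
        congrArg (fun T : Module.End ℂ (ℂ ⊗[ℚ] V) => (1 - P) * T * P) hg'
      rw [mul_add, add_mul, mul_smul_comm, mul_smul_comm, smul_mul_assoc, smul_mul_assoc, hQF, hFP,
        mul_assoc (1 - P) (E * F - F * E) P, hBP, ← mul_assoc (1 - P) E F, sub_mul 1 P E, one_mul, hPE, sub_self,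
        zero_mul, smul_zero, add_zero, mul_zero, zero_mul] at h
      exact (smul_eq_zero.1 h).resolve_right hF0
    rw [hg1, zero_smul, zero_add] at hg'
    have hg2 : g 2 = 0 := (smul_eq_zero.1 hg').resolve_right hcomm0
    intro i
    fin_cases i
    · exact hg0
    · exact hg1
    · exact hg2
  have hle : Submodule.span ℂ (Set.range v) ≤ spanC 𝔡 := by
    rw [Submodule.span_le]
    rintro _ ⟨i, rfl⟩
    exact hv i
  have hdim : Module.finrank ℂ (spanC 𝔡) ≤ Module.finrank ℂ (Submodule.span ℂ (Set.range v)) := by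
    rw [finrank_span_eq_card hli, Fintype.card_fin]
    unfold spanC
    rw [finrank_span_baseChange_image, h3]
  have heq : Submodule.span ℂ (Set.range v) = spanC 𝔡 := Submodule.eq_of_le_of_finrank_le hle hdim
  have hD' := hD
  rw [← heq, Submodule.mem_span_range_iff_exists_fun] at hD'
  obtain ⟨c, hc⟩ := hD'
  refine ⟨c, ?_⟩
  rw [← hc, Fin.sum_univ_three]
  rfl

end HodgeStructure

end Literature.AlgebraicGeometry.Motives

end
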